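import Mathlib.NumberTheory.Transcendental.Liouville.LiouvilleWith
import Mathlib.NumberTheory.Real.Irrational
import Mathlib.Analysis.SpecialFunctions.Pow.Real
import Mathlib.Analysis.SpecialFunctions.Exp
import Summits.KontsevichZagierPeriods.Zeta5Search.MeasureRecords
import HarnessLib

/-!
# ζ(5) search — "one of" WITH A MEASURED CONTAMINANT (cell `pub-zeta5`, family designer `fam-odd`)

HONEST FRAMING: systematic search; no irrationality claim unless certified.

Criteria-side support for the intermediate target **T2** ("at least one of `ζ(5), ζ(7)` is
irrational"). The T2 lane's hypergeometric forms live in `1, ζ(3), ζ(5), ζ(7)`; the printed designs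
ELIMINATE `ζ(3)` (second derivative / twist by a half) and pay for it in decay. This file types the
alternative that KEEPS `ζ(3)` and spends its known irrationality measure (census item R20 of
`families/odd/FAMILY.md` §5.15), as implications only — no certificate is constructed:
* `exists_pos_le_abs_sub_div_of_not_liouvilleWith` — `x ∉ ℚ` with `¬ LiouvilleWith p x` (`p ≥ 1`)
  has a GLOBAL measure `C/|b|^p ≤ |x - a/b|` (all `a`, all `b ≠ 0`); Mathlib's `LiouvilleWith` is an
  eventual statement, the finitely many small denominators are handled by irrationality.
* `exists_irrational_of_contaminated_forms` — integer forms `E n = a₀ n + b n·x + ∑ j, a n j·θ j`,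
  `E n ≠ 0` infinitely often, `|E n|·max(1,|b n|)^(p-1) → 0`: some `θ j ∉ ℚ`. (If all `θ j ∈ ℚ` with
  common denominator `Q`: `Q E n = A n + (Q b n) x`, `A n ∈ ℤ`; `b n = 0` gives a non-zero integer of
  size `< 1`, `b n ≠ 0` a rational `-A n/(Q b n)` closer to `x` than the measure allows.) With
  `b n = 0` throughout this is the plain "one of" criterion of `CriteriaOneOf.lean`.
* `exists_irrational_of_contaminated_rates` — on rates: `ExponentLE x κ` (`κ ≥ 1`),
  `|E n| ≤ e^{-σ n}`, `|b n| ≤ e^{τ n}` for large `n` (`τ ≥ 0`), and `(κ - 1) τ < σ`.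
* `x = ζ(3)`, `θ = (ζ(5), ζ(7))`: `zetaFiveOrSeven_of_contaminated_rates` takes the tree's cited record
  `RhinViola2001.zetaThree_irrationalityExponent_lt` (`μ(ζ(3)) < 5.513891`, named fact) as a
  HYPOTHESIS and needs `4.513891 τ < σ`; `zetaFiveOrSeven_of_contaminated_rates_apery` is
  UNCONDITIONAL (tree-proved `exponentLE_zetaThree_apery`, `μ(ζ(3)) ≤ 1 + A`,
  `A = (log(17+12√2)+3)/(log(17+12√2)-3) = 12.417…`, and `Apery.irrational_zeta_three`): `A τ < σ`.
Lane units: decay `c`, multiplier rate `C₂`, `ζ(3)`-coefficient growth `g₃` give `σ = c - C₂`,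
`τ = g₃ + C₂`, so the road needs `(μ - 1)(g₃ + C₂) < c - C₂`; exact elimination costs `g₃` against the
same budget, hence this road is DOMINATED for every `μ ≥ 2` (recorded as a closed negative with
numbers). Nearest print: Fischler–Rivoal, Proc. AMS 138 (2010) §4, `τ(ξ) = 1/(μ(ξ)-1)`
(arXiv:0910.4448). Everything is PROVED (0 `sorry`); Rhin–Viola enters only as a hypothesis.
-/

noncomputable section

open Filter Topology Finset
open Literature.NumberTheory.Transcendental
open Literature.NumberTheory.Irrationality

namespace Summit.KontsevichZagierPeriods.Zeta5Search

/-! ### From `¬ LiouvilleWith` (eventual) to a global measure -/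

/-- The distance from a real `y` to ANY integer `m` is at least `min (fract y) (1 - fract y)`. -/
private theorem min_fract_le_abs_sub_int (y : ℝ) (m : ℤ) :
    min (Int.fract y) (1 - Int.fract y) ≤ |y - m| := by
  have h1 : (⌊y⌋ : ℝ) ≤ y := Int.floor_le y
  have h2 : y < ⌊y⌋ + 1 := Int.lt_floor_add_one y
  have hf : Int.fract y = y - ⌊y⌋ := rfl
  rcases le_or_gt m ⌊y⌋ with hm | hm
  · have hm' : (m : ℝ) ≤ ⌊y⌋ := by exact_mod_cast hm
    calc min (Int.fract y) (1 - Int.fract y) ≤ Int.fract y := min_le_left _ _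
      _ ≤ |y - m| := by rw [hf]; exact le_trans (by linarith) (le_abs_self _)
  · have hm' : (⌊y⌋ : ℝ) + 1 ≤ m := by exact_mod_cast (Int.add_one_le_iff.mpr hm)
    calc min (Int.fract y) (1 - Int.fract y) ≤ 1 - Int.fract y := min_le_right _ _
      _ ≤ |y - m| := by
          rw [hf, abs_sub_comm]; exact le_trans (by linarith) (le_abs_self _)

/-- For an irrational `y`, `min (fract y) (1 - fract y)` is positive. -/
private theorem min_fract_pos_of_irrational {y : ℝ} (hy : Irrational y) :
    0 < min (Int.fract y) (1 - Int.fract y) := by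
  have h0 : 0 ≤ Int.fract y := Int.fract_nonneg y
  have h1 : Int.fract y < 1 := Int.fract_lt_one y
  have hne : Int.fract y ≠ 0 := by
    intro h
    have hf : Int.fract y = y - ⌊y⌋ := rfl
    rw [hf, sub_eq_zero] at h
    exact hy.ne_int ⌊y⌋ h
  exact lt_min (lt_of_le_of_ne h0 (Ne.symm hne)) (by linarith)

/-- **Small denominators.** For an irrational `x`, every `p ≥ 1` and every bound `N` there is a
constant `C > 0` with `C / n^p ≤ |x - m/n|` for all integers `m` and all `1 ≤ n < N`
(finitely many denominators; each contributes the positive distance of `n x` to `ℤ`). -/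
private theorem exists_pos_le_abs_sub_div_lt {x : ℝ} (hx : Irrational x) {p : ℝ} (hp : 1 ≤ p)
    (N : ℕ) : ∃ C : ℝ, 0 < C ∧ ∀ n : ℕ, 1 ≤ n → n < N → ∀ m : ℤ,
      C / (n : ℝ) ^ p ≤ |x - m / n| := by
  induction N with
  | zero => exact ⟨1, one_pos, fun n _ hn => absurd hn (Nat.not_lt_zero n)⟩
  | succ N ih =>
    obtain ⟨C, hC, hCle⟩ := ih
    rcases Nat.eq_zero_or_pos N with hN | hN
    · subst hN
      exact ⟨C, hC, fun n hn hnN => absurd hnN (by omega)⟩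
    · have hN1 : (1 : ℝ) ≤ N := by exact_mod_cast hN
      have hN0 : (0 : ℝ) < N := by exact_mod_cast hN
      have hNne : (N : ℝ) ≠ 0 := hN0.ne'
      set g : ℝ := min (Int.fract ((N : ℝ) * x)) (1 - Int.fract ((N : ℝ) * x)) with hg
      have hNx : Irrational ((N : ℝ) * x) := hx.natCast_mul hN.ne'
      have hgpos : 0 < g := min_fract_pos_of_irrational hNx
      -- the bound at the denominator `N`: `|x - m/N| = |N x - m| / N ≥ g / N ≥ g / N^p`
      have hcase : ∀ m : ℤ, min C g / (N : ℝ) ^ p ≤ |x - m / N| := by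
        intro m
        have hNp : (N : ℝ) ≤ (N : ℝ) ^ p := by
          calc (N : ℝ) = (N : ℝ) ^ (1 : ℝ) := (Real.rpow_one _).symm
            _ ≤ (N : ℝ) ^ p := Real.rpow_le_rpow_of_exponent_le hN1 hp
        have hxm : |x - m / N| = |(N : ℝ) * x - m| / N := by
          have e : x - m / N = ((N : ℝ) * x - m) / N := by field_simp
          rw [e, abs_div, Nat.abs_cast]
        rw [hxm]
        calc min C g / (N : ℝ) ^ p ≤ g / (N : ℝ) ^ p := by gcongr; exact min_le_right _ _
          _ ≤ g / N := div_le_div_of_nonneg_left hgpos.le hN0 hNp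
          _ ≤ |(N : ℝ) * x - m| / N := by gcongr; exact min_fract_le_abs_sub_int _ m
      refine ⟨min C g, lt_min hC hgpos, fun n hn hnN m => ?_⟩
      rcases (Nat.lt_succ_iff.1 hnN).lt_or_eq with hlt | heq
      · have hn0 : (0 : ℝ) < n := by exact_mod_cast hn
        have hnp : 0 < (n : ℝ) ^ p := Real.rpow_pos_of_pos hn0 p
        calc min C g / (n : ℝ) ^ p ≤ C / (n : ℝ) ^ p := by gcongr; exact min_le_left _ _
          _ ≤ |x - m / n| := hCle n hn hlt m
      · rw [heq]; exact hcase m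

/-- **Global measure from `¬ LiouvilleWith`.** If `x` is irrational and not `p`-Liouville
(`p ≥ 1`), then there is `C > 0` with `C / |b|^p ≤ |x - a/b|` for ALL integers `a` and `b ≠ 0`.
(`LiouvilleWith p x` unfolds to: for some `C`, `|x - m/n| < C/n^p` for infinitely many `n`; its
negation with `C = 1` bounds all large denominators, `exists_pos_le_abs_sub_div_lt` the small ones.) -/
theorem exists_pos_le_abs_sub_div_of_not_liouvilleWith {x p : ℝ} (hx : Irrational x) (hp : 1 ≤ p)
    (hL : ¬ LiouvilleWith p x) :
    ∃ C : ℝ, 0 < C ∧ ∀ a b : ℤ, b ≠ 0 → C / |(b : ℝ)| ^ p ≤ |x - a / b| := by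
  -- large denominators: the negation of `LiouvilleWith` with the constant `1`
  have hlarge : ∀ᶠ n : ℕ in atTop, ∀ m : ℤ, (1 : ℝ) / (n : ℝ) ^ p ≤ |x - m / n| := by
    have h : ¬ ∃ᶠ n : ℕ in atTop, ∃ m : ℤ, x ≠ m / n ∧ |x - m / n| < 1 / (n : ℝ) ^ p :=
      fun h => hL ⟨1, h⟩
    rw [Filter.not_frequently] at h
    filter_upwards [h] with n hn m
    by_contra hlt
    refine hn ⟨m, ?_, lt_of_not_ge hlt⟩
    intro hxm
    exact hx ⟨(m : ℚ) / (n : ℚ), by push_cast; exact hxm.symm⟩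
  obtain ⟨N, hN⟩ := Filter.eventually_atTop.1 hlarge
  obtain ⟨C, hC, hsmall⟩ := exists_pos_le_abs_sub_div_lt hx hp N
  have hnat : ∀ n : ℕ, 1 ≤ n → ∀ a : ℤ, min 1 C / (n : ℝ) ^ p ≤ |x - a / n| := by
    intro n hn1 a
    have hn0 : (0 : ℝ) < n := by exact_mod_cast hn1
    have hnp : 0 < (n : ℝ) ^ p := Real.rpow_pos_of_pos hn0 p
    rcases lt_or_ge n N with hlt | hge
    · calc min 1 C / (n : ℝ) ^ p ≤ C / (n : ℝ) ^ p := by gcongr; exact min_le_right _ _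
        _ ≤ |x - a / n| := hsmall n hn1 hlt a
    · calc min 1 C / (n : ℝ) ^ p ≤ 1 / (n : ℝ) ^ p := by gcongr; exact min_le_left _ _
        _ ≤ |x - a / n| := hN n hge a
  refine ⟨min 1 C, lt_min one_pos hC, fun a b hb => ?_⟩
  -- an integer denominator is `n` or `-n`
  obtain ⟨n, rfl | rfl⟩ := Int.eq_nat_or_neg b
  · have hn1 : 1 ≤ n := Nat.one_le_iff_ne_zero.mpr fun h => hb (by simp [h])
    rw [Int.cast_natCast, Nat.abs_cast]
    exact hnat n hn1 a
  · have hn1 : 1 ≤ n := Nat.one_le_iff_ne_zero.mpr fun h => hb (by simp [h])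
    have h := hnat n hn1 (-a)
    rw [Int.cast_neg, neg_div] at h
    rw [Int.cast_neg, Int.cast_natCast, abs_neg, Nat.abs_cast, div_neg]
    exact h

/-! ### The criterion: forms in `1, x, θ₁, …, θ_k` with a measured contaminant `x` -/

/-- **"One of" with a measured contaminant.** Let `x` be irrational and not `p`-Liouville
(`p ≥ 1`), and let `E n = a₀ n + b n · x + ∑ j, a n j · θ j` be INTEGER linear forms with
`E n ≠ 0` for infinitely many `n` and `|E n| · max(1, |b n|)^(p-1) → 0`. Then at least one `θ j`
is irrational. (If all `θ j ∈ ℚ` with common denominator `Q`: `Q E n = A n + (Q b n) x`, `A n ∈ ℤ`;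
at an index with `E n ≠ 0` and the product small, `b n = 0` contradicts `|A n| ≥ 1` and `b n ≠ 0`
contradicts the global measure `C/|Q b n|^p ≤ |x + A n/(Q b n)|`.) -/
theorem exists_irrational_of_contaminated_forms {ι : Type*} [Fintype ι] (θ : ι → ℝ) (x : ℝ)
    {p : ℝ} (hp : 1 ≤ p) (hx : Irrational x) (hL : ¬ LiouvilleWith p x)
    (a₀ b : ℕ → ℤ) (a : ℕ → ι → ℤ) (E : ℕ → ℝ)
    (hE : ∀ n, E n = a₀ n + b n * x + ∑ j, (a n j : ℝ) * θ j)
    (hne : ∃ᶠ n : ℕ in atTop, E n ≠ 0)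
    (hsmall : Tendsto (fun n => |E n| * max 1 |(b n : ℝ)| ^ (p - 1)) atTop (𝓝 0)) :
    ∃ j, Irrational (θ j) := by
  by_contra hall
  push Not at hall
  have hrat : ∀ j, ∃ q : ℚ, θ j = q := fun j => by
    have h := hall j
    unfold Irrational at h
    push Not at h
    exact ⟨h.choose, h.choose_spec.symm⟩
  choose q hq using hrat
  -- common denominator `Q` and integers `z j = Q θ j`
  set Q : ℕ := ∏ j, (q j).den with hQdef
  have hQpos : 0 < Q := Finset.prod_pos fun j _ => (q j).den_pos
  have hQR : (0 : ℝ) < Q := by exact_mod_cast hQpos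
  have hQne : (Q : ℝ) ≠ 0 := hQR.ne'
  have hz : ∀ j, ∃ z : ℤ, (Q : ℝ) * θ j = z := by
    intro j
    obtain ⟨k, hk⟩ : (q j).den ∣ Q := Finset.dvd_prod_of_mem (fun i => (q i).den) (mem_univ j)
    refine ⟨k * (q j).num, ?_⟩
    have hden : ((q j : ℚ) * ((q j).den : ℚ) : ℝ) = (((q j).num : ℚ) : ℝ) := by
      exact_mod_cast Rat.mul_den_eq_num (q j)
    push_cast at hden
    rw [hq j, hk]
    push_cast
    calc (((q j).den : ℝ) * (k : ℝ)) * (q j : ℝ) = k * ((q j : ℝ) * ((q j).den : ℝ)) := by ring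
      _ = k * ((q j).num : ℝ) := by rw [hden]
  choose z hz using hz
  -- `Q E n = A n + (Q b n) x` with the integer `A n = Q a₀ n + ∑ j, a n j z j`
  have hQE : ∀ n, (Q : ℝ) * E n =
      ((Q * a₀ n + ∑ j, a n j * z j : ℤ) : ℝ) + ((Q * b n : ℤ) : ℝ) * x := by
    intro n
    rw [hE n]
    push_cast
    have hs : ∑ j, (a n j : ℝ) * (z j : ℝ) = (Q : ℝ) * ∑ j, (a n j : ℝ) * θ j := by
      rw [Finset.mul_sum]
      exact Finset.sum_congr rfl fun j _ => by rw [← hz j]; ring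
    rw [hs]
    ring
  obtain ⟨C, hC, hCle⟩ := exists_pos_le_abs_sub_div_of_not_liouvilleWith hx hp hL
  have hQp : 0 < (Q : ℝ) ^ p := Real.rpow_pos_of_pos hQR p
  -- an index where the form is non-zero AND the product is below both thresholds
  set ε : ℝ := min (1 / Q) (C / (Q : ℝ) ^ p) with hε
  have hεpos : 0 < ε := lt_min (div_pos one_pos hQR) (div_pos hC hQp)
  have hev : ∀ᶠ n : ℕ in atTop, |E n| * max 1 |(b n : ℝ)| ^ (p - 1) < ε :=
    (tendsto_order.1 hsmall).2 ε hεpos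
  obtain ⟨n, hEn, hlt⟩ := (hne.and_eventually hev).exists
  set A : ℤ := Q * a₀ n + ∑ j, a n j * z j with hA
  rcases eq_or_ne (b n) 0 with hb0 | hb0
  · -- `b n = 0`: `Q E n = A` is a non-zero integer, so `|E n| ≥ 1/Q > ε`
    have hQEA : (Q : ℝ) * E n = (A : ℝ) := by
      rw [hQE n, ← hA, hb0, mul_zero, Int.cast_zero, zero_mul, add_zero]
    have hA0 : A ≠ 0 := by
      intro h
      apply hEn
      have h0 : (Q : ℝ) * E n = 0 := by rw [hQEA, h, Int.cast_zero]
      rcases mul_eq_zero.1 h0 with h1 | h1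
      · exact absurd h1 hQne
      · exact h1
    have h1 : (1 : ℝ) ≤ (Q : ℝ) * |E n| := by
      have h := Int.one_le_abs hA0
      have h' : ((1 : ℤ) : ℝ) ≤ ((|A| : ℤ) : ℝ) := by exact_mod_cast h
      rw [Int.cast_one, Int.cast_abs, ← hQEA, abs_mul, Nat.abs_cast] at h'
      exact h'
    have hmax : max 1 |((b n : ℤ) : ℝ)| ^ (p - 1) = 1 := by
      rw [hb0, Int.cast_zero, abs_zero, max_eq_left (zero_le_one : (0 : ℝ) ≤ 1), Real.one_rpow]
    rw [hmax, mul_one] at hlt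
    have hεle : ε ≤ 1 / Q := min_le_left _ _
    have hge : (1 : ℝ) / Q ≤ |E n| := by
      rw [div_le_iff₀ hQR]; linarith
    linarith
  · -- `b n ≠ 0`: the rational `-A/(Q b n)` is too close to `x`
    set B : ℤ := Q * b n with hB
    have hB0 : B ≠ 0 := mul_ne_zero (by exact_mod_cast hQpos.ne') hb0
    have hBR : (B : ℝ) ≠ 0 := by exact_mod_cast hB0
    have hb1 : (1 : ℝ) ≤ |(b n : ℝ)| := by
      have h := Int.one_le_abs hb0
      have h' : ((1 : ℤ) : ℝ) ≤ ((|b n| : ℤ) : ℝ) := by exact_mod_cast h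
      rwa [Int.cast_one, Int.cast_abs] at h'
    have hbpos : 0 < |(b n : ℝ)| := lt_of_lt_of_le one_pos hb1
    have hBabs : |(B : ℝ)| = (Q : ℝ) * |(b n : ℝ)| := by
      rw [hB]; push_cast; rw [abs_mul, Nat.abs_cast]
    have hm := hCle (-A) B hB0
    have hxB : |x - ((-A : ℤ) : ℝ) / B| = |E n| / |(b n : ℝ)| := by
      have e : x - ((-A : ℤ) : ℝ) / B = ((Q : ℝ) * E n) / B := by
        rw [hQE n, ← hA, ← hB]
        push_cast
        field_simp
        ring
      rw [e, abs_div, hBabs, abs_mul, Nat.abs_cast, mul_div_mul_left _ _ hQne]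
    rw [hxB, hBabs, Real.mul_rpow hQR.le hbpos.le] at hm
    -- `hm : C / (Q^p |b|^p) ≤ |E| / |b|`; rewrite `|b|^p = |b|^(p-1) |b|` and cancel `|b|`
    have hsplit : |(b n : ℝ)| ^ p = |(b n : ℝ)| ^ (p - 1) * |(b n : ℝ)| := by
      rw [← Real.rpow_add_one hbpos.ne' (p - 1), sub_add_cancel]
    have hbp1 : 0 < |(b n : ℝ)| ^ (p - 1) := Real.rpow_pos_of_pos hbpos _
    have hden : 0 < (Q : ℝ) ^ p * (|(b n : ℝ)| ^ (p - 1) * |(b n : ℝ)|) :=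
      mul_pos hQp (mul_pos hbp1 hbpos)
    rw [hsplit, div_le_div_iff₀ hden hbpos] at hm
    have key : C / (Q : ℝ) ^ p ≤ |E n| * |(b n : ℝ)| ^ (p - 1) := by
      rw [div_le_iff₀ hQp]
      have hm' : C * |(b n : ℝ)| ≤
          (|E n| * |(b n : ℝ)| ^ (p - 1) * (Q : ℝ) ^ p) * |(b n : ℝ)| := by
        have e : |E n| * ((Q : ℝ) ^ p * (|(b n : ℝ)| ^ (p - 1) * |(b n : ℝ)|)) =
            (|E n| * |(b n : ℝ)| ^ (p - 1) * (Q : ℝ) ^ p) * |(b n : ℝ)| := by ring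
        rw [← e]; exact hm
      exact le_of_mul_le_mul_right hm' hbpos
    have hmax : max 1 |(b n : ℝ)| = |(b n : ℝ)| := max_eq_right hb1
    rw [hmax] at hlt
    have hεle : ε ≤ C / (Q : ℝ) ^ p := min_le_right _ _
    linarith

/-- **The `μ(x) ≤ κ` form.** With `ExponentLE x κ` (`κ ≥ 1`) in place of `¬ LiouvilleWith p x`:
integer forms `E n = a₀ n + b n x + ∑ a n j θ j`, non-zero infinitely often, with
`|E n| ≤ e^{-σ n}` and `|b n| ≤ e^{τ n}` for large `n` (`τ ≥ 0`) and `(κ - 1) τ < σ` force some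
`θ j ∉ ℚ`. (Choose `p > κ` with `(p - 1) τ < σ` still.) -/
theorem exists_irrational_of_contaminated_rates {ι : Type*} [Fintype ι] (θ : ι → ℝ) (x : ℝ)
    {κ : ℝ} (hκ : 1 ≤ κ) (hx : Irrational x) (hexp : ExponentLE x κ)
    (a₀ b : ℕ → ℤ) (a : ℕ → ι → ℤ) (E : ℕ → ℝ)
    (hE : ∀ n, E n = a₀ n + b n * x + ∑ j, (a n j : ℝ) * θ j)
    (hne : ∃ᶠ n : ℕ in atTop, E n ≠ 0) {σ τ : ℝ} (hτ : 0 ≤ τ)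
    (hdecay : ∀ᶠ n : ℕ in atTop, |E n| ≤ Real.exp (-(σ * n)))
    (hcoeff : ∀ᶠ n : ℕ in atTop, |(b n : ℝ)| ≤ Real.exp (τ * n))
    (hmargin : (κ - 1) * τ < σ) : ∃ j, Irrational (θ j) := by
  -- an exponent `p > κ` keeping the margin
  set η : ℝ := (σ - (κ - 1) * τ) / (2 * (τ + 1)) with hη
  have hgap : 0 < σ - (κ - 1) * τ := by linarith
  have hηpos : 0 < η := by rw [hη]; exact div_pos hgap (by linarith)
  set p : ℝ := κ + η with hpdef
  have hp : 1 ≤ p := by rw [hpdef]; linarith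
  have hκp : κ < p := by rw [hpdef]; linarith
  have hrate : 0 < σ - (p - 1) * τ := by
    have h1 : η * τ ≤ (σ - (κ - 1) * τ) / 2 := by
      rw [hη, div_mul_eq_mul_div, div_le_div_iff₀ (by linarith) (by norm_num : (0:ℝ) < 2)]
      nlinarith [hgap, hτ]
    have e : σ - (p - 1) * τ = (σ - (κ - 1) * τ) - η * τ := by rw [hpdef]; ring
    rw [e]; linarith
  refine exists_irrational_of_contaminated_forms θ x hp hx (hexp p hκp) a₀ b a E hE hne ?_
  -- `0 ≤ |E n| max(1,|b n|)^(p-1) ≤ e^{-(σ - (p-1)τ) n} → 0`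
  have hp1 : 0 ≤ p - 1 := by linarith
  have hup : Tendsto (fun n : ℕ => Real.exp (-((σ - (p - 1) * τ) * n))) atTop (𝓝 0) := by
    exact Real.tendsto_exp_neg_atTop_nhds_zero.comp
      (tendsto_natCast_atTop_atTop.const_mul_atTop hrate)
  refine squeeze_zero' (Eventually.of_forall fun n => by positivity) ?_ hup
  filter_upwards [hdecay, hcoeff] with n hd hc
  have hmax1 : (1 : ℝ) ≤ max 1 |(b n : ℝ)| := le_max_left _ _
  have hmaxle : max 1 |(b n : ℝ)| ≤ Real.exp (τ * n) :=
    max_le (Real.one_le_exp (mul_nonneg hτ (Nat.cast_nonneg n))) hc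
  calc |E n| * max 1 |(b n : ℝ)| ^ (p - 1)
      ≤ Real.exp (-(σ * n)) * Real.exp (τ * n) ^ (p - 1) :=
        mul_le_mul hd (Real.rpow_le_rpow (le_trans zero_le_one hmax1) hmaxle hp1)
          (Real.rpow_nonneg (le_trans zero_le_one hmax1) _) (Real.exp_pos _).le
    _ = Real.exp (-((σ - (p - 1) * τ) * n)) := by
        rw [← Real.exp_mul, ← Real.exp_add]; congr 1; ring

/-! ### Instances: `x = ζ(3)`, `θ = (ζ(5), ζ(7))` -/

/-- **T2 with `ζ(3)` kept — conditional on the Rhin–Viola record.** Integer forms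
`E n = a₀ n + a₃ n ζ(3) + a₅ n ζ(5) + a₇ n ζ(7)`, non-zero infinitely often, `|E n| ≤ e^{-σ n}` and
`|a₃ n| ≤ e^{τ n}` for large `n` (`τ ≥ 0`), `4.513891 τ < σ`, TOGETHER WITH the tree's cited record
`RhinViola2001.zetaThree_irrationalityExponent_lt` (`μ(ζ(3)) < 5.513891`, a hypothesis here): then
`ζ(5) ∉ ℚ` or `ζ(7) ∉ ℚ`. Implication only; no such forms are known (`FAMILY.md` §5.15: factor ≈ 20). -/
theorem zetaFiveOrSeven_of_contaminated_rates
    (hRV : RhinViola2001.zetaThree_irrationalityExponent_lt)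
    (a₀ a₃ a₅ a₇ : ℕ → ℤ) (E : ℕ → ℝ)
    (hE : ∀ n, E n = a₀ n + a₃ n * zetaValue 3 + a₅ n * zetaValue 5 + a₇ n * zetaValue 7)
    (hne : ∃ᶠ n : ℕ in atTop, E n ≠ 0) {σ τ : ℝ} (hτ : 0 ≤ τ)
    (hdecay : ∀ᶠ n : ℕ in atTop, |E n| ≤ Real.exp (-(σ * n)))
    (hcoeff : ∀ᶠ n : ℕ in atTop, |(a₃ n : ℝ)| ≤ Real.exp (τ * n))
    (hmargin : 4.513891 * τ < σ) :
    Irrational (zetaValue 5) ∨ Irrational (zetaValue 7) := by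
  set θ : Fin 2 → ℝ := ![zetaValue 5, zetaValue 7] with hθ
  have hexp : ExponentLE (zetaValue 3) 5.513891 := fun p hp => hRV p hp.le
  have hE' : ∀ n, E n = a₀ n + a₃ n * zetaValue 3 +
      ∑ j, (((![a₅ n, a₇ n] : Fin 2 → ℤ) j : ℤ) : ℝ) * θ j := by
    intro n
    rw [hE n]
    simp [hθ, Fin.sum_univ_two, add_assoc]
  obtain ⟨j, hj⟩ := exists_irrational_of_contaminated_rates θ (zetaValue 3) (κ := 5.513891)
    (by norm_num) Apery.irrational_zeta_three hexp a₀ a₃ (fun n => ![a₅ n, a₇ n]) E hE' hne hτ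
    hdecay hcoeff (by linarith)
  fin_cases j
  · exact Or.inl (by simpa [hθ] using hj)
  · exact Or.inr (by simpa [hθ] using hj)

/-- **T2 with `ζ(3)` kept — UNCONDITIONAL (Apéry's exponent).** The same with the tree's PROVED
exponent bound `exponentLE_zetaThree_apery` (`μ(ζ(3)) ≤ 1 + A`,
`A = (log(17+12√2) + 3)/(log(17+12√2) - 3) = 12.417…`) and Apéry's theorem: integer forms in
`1, ζ(3), ζ(5), ζ(7)`, non-zero infinitely often, with `|E n| ≤ e^{-σ n}`, `|a₃ n| ≤ e^{τ n}`
(`τ ≥ 0`) and `A τ < σ` give `ζ(5) ∉ ℚ` or `ζ(7) ∉ ℚ`. No named fact enters; implication only —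
no such forms are known. -/
theorem zetaFiveOrSeven_of_contaminated_rates_apery
    (a₀ a₃ a₅ a₇ : ℕ → ℤ) (E : ℕ → ℝ)
    (hE : ∀ n, E n = a₀ n + a₃ n * zetaValue 3 + a₅ n * zetaValue 5 + a₇ n * zetaValue 7)
    (hne : ∃ᶠ n : ℕ in atTop, E n ≠ 0) {σ τ : ℝ} (hτ : 0 ≤ τ)
    (hdecay : ∀ᶠ n : ℕ in atTop, |E n| ≤ Real.exp (-(σ * n)))
    (hcoeff : ∀ᶠ n : ℕ in atTop, |(a₃ n : ℝ)| ≤ Real.exp (τ * n))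
    (hmargin : (Real.log (17 + 12 * Real.sqrt 2) + 3) / (Real.log (17 + 12 * Real.sqrt 2) - 3)
      * τ < σ) :
    Irrational (zetaValue 5) ∨ Irrational (zetaValue 7) := by
  set θ : Fin 2 → ℝ := ![zetaValue 5, zetaValue 7] with hθ
  set A : ℝ := (Real.log (17 + 12 * Real.sqrt 2) + 3) / (Real.log (17 + 12 * Real.sqrt 2) - 3)
    with hA
  -- `A ≥ 0` (indeed `log(17+12√2) = 3.52… > 3`), so `κ = 1 + A ≥ 1`
  have hlog : 3 < Real.log (17 + 12 * Real.sqrt 2) := by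
    have hs : (1.41 : ℝ) < Real.sqrt 2 := by
      rw [show (1.41 : ℝ) = Real.sqrt (1.41 ^ 2) by rw [Real.sqrt_sq (by norm_num)]]
      exact Real.sqrt_lt_sqrt (by norm_num) (by norm_num)
    have h20 : Real.exp 3 < 17 + 12 * Real.sqrt 2 := by
      have he : Real.exp 3 < 20.1 := by
        have := Real.exp_one_lt_d9
        calc Real.exp 3 = Real.exp 1 ^ 3 := by rw [Real.exp_one_pow]; norm_num
          _ < 2.7182818286 ^ 3 := by gcongr
          _ < 20.1 := by norm_num
      linarith
    calc (3 : ℝ) = Real.log (Real.exp 3) := (Real.log_exp 3).symm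
      _ < Real.log (17 + 12 * Real.sqrt 2) := Real.log_lt_log (Real.exp_pos 3) h20
  have hApos : 0 ≤ A := by rw [hA]; exact div_nonneg (by linarith) (by linarith)
  have hE' : ∀ n, E n = a₀ n + a₃ n * zetaValue 3 +
      ∑ j, (((![a₅ n, a₇ n] : Fin 2 → ℤ) j : ℤ) : ℝ) * θ j := by
    intro n
    rw [hE n]
    simp [hθ, Fin.sum_univ_two, add_assoc]
  have hmargin' : (1 + A - 1) * τ < σ := by rw [add_sub_cancel_left]; exact hmargin
  obtain ⟨j, hj⟩ := exists_irrational_of_contaminated_rates θ (zetaValue 3) (κ := 1 + A)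
    (by linarith) Apery.irrational_zeta_three exponentLE_zetaThree_apery a₀ a₃
    (fun n => ![a₅ n, a₇ n]) E hE' hne hτ hdecay hcoeff hmargin'
  fin_cases j
  · exact Or.inl (by simpa [hθ] using hj)
  · exact Or.inr (by simpa [hθ] using hj)

end Summit.KontsevichZagierPeriods.Zeta5Search
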